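import Literature.NumberTheory.Automorphic.Liu2021.CheckOfChi
import Literature.NumberTheory.Automorphic.Liu2021.Def411WeilCarriersIrreducibleOfLemD1
import Literature.NumberTheory.Automorphic.Liu2021.Def411WeilCarriersChiUnitary
import Literature.NumberTheory.Automorphic.UnitaryGroupSplitPlace
import HarnessLib

/-!
# `χ̌` read place by place: `χ̌_w = χ_v ∘ (z ↦ z_w)⁻¹` at a place `w ∣ v` of `E` split over `F`

[Liu2021, App. D §D.1 (l. 5224)]: «we define a character `χ̌` of `E^×` via the formula `χ̌(x) = χ(x/xᶜ)`»; [Liu2021, proof of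
Lemma D.1, first paragraph (l. 5241), the split case `E = F × F`]: «Note that the first component of `χ̌` is simply `χ`» — i.e. at
a place `v` of `F` split in `E`, `E_v¹ = {z ∈ E_w × E_{w̄} : z_w z̄_{w̄} = 1} ≅ E_wˣ` by `z ↦ z_w`, under which the local component
`χ_v` of `χ` becomes the character `χ̌_w` of `E_wˣ` (the reading of the second Levi character `χ` of the principal series
`(ν∘det) ⊠ χν^{1-n}` there, and of `μ′ = μᶜχ̌` in Lemma D.1 (4), l. 5235).

Sequel of `CheckOfChi` (the global Hecke character `χ̌ = HeckeCharacter.checkOfChi hcc χ`).  KERNEL ONLY: theorems; no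
definition, no named fact, no `sorry`.  Setting: `E/F` quadratic with non-trivial automorphism `c` (`hcc : c * c = 1`),
`χ : Chi F E c` an automorphic character of `U(1)(𝔸_{F,f}) = finAdelicOne F E c`.

* §1 the `{w, c • w}` dictionary in `𝔸_E^∞`: `(single_w(x))ᶜ = single_{c•w}(c_* x)` (`conjFiniteAdele_finiteAdeleSingle`),
  hence the norm-one finite idèle `single_w(u)/single_w(u)ᶜ = single_w(u) · single_{c•w}(c_* u)⁻¹` fed to `χ` by `χ̌_w`
  (`coe_finAdelicCheck_unitsMap_finiteAdeleSingle`) and its three kinds of components at a place `w` with `c • w ≠ w`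
  (`…_apply_self` = `u`, `…_apply_smul` = `c_* u⁻¹`, `…_apply_of_ne` = `1`);
* §2 `localComponent_checkOfChi` — `χ̌_w(u) = χ(single_w(u) / single_{c•w}(c_* u))` (with the membership
  `unitsMap_finiteAdeleSingle_div_mem_finAdelicOne` and `finAdelicCheck_unitsMap_finiteAdeleSingle`);
* §3 **the graph identity at a split place** (`[Algebra.IsQuadraticExtension F E]`, `c ≠ 1`, a line `J₁ = (j)`, `j ≠ 0`,
  `w ∣ v` with `c • w ≠ w`): for every `z ∈ U(J₁)(F_v) = E_v¹`,
  **`χ̌_w(det z_w) = χ_v(z)`** where `χ_v = UnitaryGroup.localCharOfCenter … χ v` is the tree's local component of `χ` at `v`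
  (`localComponent_checkOfChi_det`; finite-idèle form `finAdelicCheck_unitsMap_finiteAdeleSingle_det`).  This is EXACTLY the
  input `hχ'` of ★ `splitPlace_chiCoinv_iso_parabolicIndGL_explicit` (`SplitPlaceOscillatorModelExplicit`) for the local
  central character `χ := χ_v` and `χ′ := χ̌.localComponent w` (`forall_localComponent_checkOfChi_det`): the second Levi
  character `χ′` of the split-place model of [Liu2021, Lem. D.1 (2)] IS the `w`-component of the global `χ̌`;
* §4 `valueAtUniformizer_checkOfChi` (unfolding), `valueAtUniformizer_checkOfChi_eq_localCharOfCenter` (at a split place, for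
  any `z ∈ E_v¹` with `w`-coordinate the chosen uniformiser), `isUnitary_checkOfChi` (`‖χ̌‖ = 1`, from ★ `norm_chi_apply_eq_one`).

HC_CM is NOT proved by anything here (count-neutral bookkeeping for the d6 line's S4).

## References
* [Liu2021] Y. Liu, *Fourier–Jacobi cycles and arithmetic relative trace formula*, Camb. J. Math. 9 (2021) = arXiv:2102.11518,
  Def. 4.11 (l. 2090), App. D §D.1 Step 3 and the definition of `χ̌` (l. 5221–5224), Lemma D.1 (4) (l. 5235), proof of Lemma D.1,
  first paragraph (l. 5241), proof of Thm. D.6 (1) (l. 5624).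
* [TateThesis1967] J. Tate, *Fourier analysis in number fields and Hecke's zeta-functions*, in Cassels–Fröhlich (1967), §3.2
  Lemma 3.2.1 (local components of a character of a restricted product).
* [CasselsFrohlichANT1967] Cassels–Fröhlich, *Algebraic Number Theory* (1967), Ch. VII §1.1, Prop. 1.2 (ii) (Galois action on
  places and completions).
-/

set_option autoImplicit false

noncomputable section

open NumberField IsDedekindDomain
open scoped RestrictedProduct Classical

namespace Literature.NumberTheory.Automorphic.Liu2021.CheckOfChi

open Literature.NumberTheory.GaloisRepresentations
open Literature.NumberTheory.Automorphic.UnitaryGroup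
open Literature.NumberTheory.Automorphic.Liu2021.Def411WeilCarriers

variable {F E : Type} [Field F] [NumberField F] [Field E] [NumberField E] [Algebra F E] {c : E ≃ₐ[F] E}

/-! ## §1 The `{w, c • w}` dictionary in the finite adèle ring -/

omit [NumberField F] [Algebra F E] in
/-- components of a product of finite adèles (definitional). [folklore] -/
private theorem finiteAdele_mul_apply (a b : FiniteAdeleRing (𝓞 E) E) (x : HeightOneSpectrum (𝓞 E)) :
    (a * b) x = a x * b x := rfl

omit [NumberField F] in
/-- **`(single_w(x))ᶜ = single_{c • w}(c_* x)`**: the automorphism `c ⊗ 1` of `𝔸_E^∞` carries the `w`-th factor embedding to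
the `c • w`-th (tree `FiniteAdeleRing.smul_mulSingle`, restated for `finiteAdeleSingle`/`conjFiniteAdele`).
[cite: CasselsFrohlichANT1967, Ch. VII §1.1] -/
theorem conjFiniteAdele_finiteAdeleSingle (w : HeightOneSpectrum (𝓞 E)) (x : w.adicCompletion E) :
    conjFiniteAdele F E c (finiteAdeleSingle w x) = finiteAdeleSingle (c • w) (galAdicCompletionMap c rfl x) := by
  refine FiniteAdeleRing.ext E fun u => ?_
  rw [conjFiniteAdele_apply_apply]
  by_cases hu : u = c • w
  · subst hu
    rw [finiteAdeleSingle_apply_self,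
      galAdicCompletionMap_apply_congr_place E (inv_smul_smul c w) _ rfl (⇑(finiteAdeleSingle w x)),
      finiteAdeleSingle_apply_self]
  · have hu' : c⁻¹ • u ≠ w := fun h => hu (by rw [← h, smul_inv_smul])
    rw [finiteAdeleSingle_apply_of_ne _ hu', finiteAdeleSingle_apply_of_ne _ hu, map_one]

omit [NumberField F] in
/-- **the norm-one finite idèle `single_w(u) / single_w(u)ᶜ = single_w(u) · single_{c • w}(c_* u⁻¹)`** (as an element of
`𝔸_E^∞`) — the argument of `χ` in `χ̌_w(u)`. [cite: Liu2021, App. D §D.1 (l. 5224)] -/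
theorem coe_finAdelicCheck_unitsMap_finiteAdeleSingle (hcc : c * c = 1) (w : HeightOneSpectrum (𝓞 E))
    (u : (w.adicCompletion E)ˣ) :
    (((finAdelicCheck F E c hcc (Units.map (finiteAdeleSingle w) u) : finAdelicOne F E c) :
        (FiniteAdeleRing (𝓞 E) E)ˣ) : FiniteAdeleRing (𝓞 E) E) =
      finiteAdeleSingle w (u : w.adicCompletion E) *
        finiteAdeleSingle (c • w) (galAdicCompletionMap c rfl ((u⁻¹ : (w.adicCompletion E)ˣ) : w.adicCompletion E)) := by
  rw [coe_finAdelicCheck, div_eq_mul_inv, ← map_inv, ← map_inv, Units.val_mul, Units.coe_map, Units.coe_map,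
    Units.coe_map]
  change finiteAdeleSingle w (u : w.adicCompletion E) * conjFiniteAdele F E c (finiteAdeleSingle w _) = _
  rw [conjFiniteAdele_finiteAdeleSingle]

omit [NumberField F] in
/-- its `w`-component is `u` (for `c • w ≠ w`). [cite: Liu2021, App. D §D.1 (l. 5224)] -/
theorem finAdelicCheck_unitsMap_finiteAdeleSingle_apply_self (hcc : c * c = 1) {w : HeightOneSpectrum (𝓞 E)}
    (hw : c • w ≠ w) (u : (w.adicCompletion E)ˣ) :
    (((finAdelicCheck F E c hcc (Units.map (finiteAdeleSingle w) u) : finAdelicOne F E c) :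
        (FiniteAdeleRing (𝓞 E) E)ˣ) : FiniteAdeleRing (𝓞 E) E) w = u := by
  rw [coe_finAdelicCheck_unitsMap_finiteAdeleSingle, finiteAdele_mul_apply, finiteAdeleSingle_apply_self,
    finiteAdeleSingle_apply_of_ne _ (Ne.symm hw), mul_one]

omit [NumberField F] in
/-- its `c • w`-component is `c_* u⁻¹` (for `c • w ≠ w`). [cite: Liu2021, App. D §D.1 (l. 5224)] -/
theorem finAdelicCheck_unitsMap_finiteAdeleSingle_apply_smul (hcc : c * c = 1) {w : HeightOneSpectrum (𝓞 E)}
    (hw : c • w ≠ w) (u : (w.adicCompletion E)ˣ) :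
    (((finAdelicCheck F E c hcc (Units.map (finiteAdeleSingle w) u) : finAdelicOne F E c) :
        (FiniteAdeleRing (𝓞 E) E)ˣ) : FiniteAdeleRing (𝓞 E) E) (c • w) =
      galAdicCompletionMap c rfl ((u⁻¹ : (w.adicCompletion E)ˣ) : w.adicCompletion E) := by
  rw [coe_finAdelicCheck_unitsMap_finiteAdeleSingle, finiteAdele_mul_apply, finiteAdeleSingle_apply_self,
    finiteAdeleSingle_apply_of_ne _ hw, one_mul]

omit [NumberField F] in
/-- its components away from `{w, c • w}` are `1`. [cite: Liu2021, App. D §D.1 (l. 5224)] -/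
theorem finAdelicCheck_unitsMap_finiteAdeleSingle_apply_of_ne (hcc : c * c = 1) {w x : HeightOneSpectrum (𝓞 E)}
    (h₁ : x ≠ w) (h₂ : x ≠ c • w) (u : (w.adicCompletion E)ˣ) :
    (((finAdelicCheck F E c hcc (Units.map (finiteAdeleSingle w) u) : finAdelicOne F E c) :
        (FiniteAdeleRing (𝓞 E) E)ˣ) : FiniteAdeleRing (𝓞 E) E) x = 1 := by
  rw [coe_finAdelicCheck_unitsMap_finiteAdeleSingle, finiteAdele_mul_apply, finiteAdeleSingle_apply_of_ne _ h₁,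
    finiteAdeleSingle_apply_of_ne _ h₂, one_mul]

/-! ## §2 The local component `χ̌_w` -/

omit [NumberField F] in
/-- as units of `𝔸_E^∞`: `single_w(u)/single_w(u)ᶜ = single_w(u) / single_{c • w}(c_* u)` (the value of `finAdelicCheck` on a
local unit, with the conjugate factor moved to the place `c • w`). [cite: Liu2021, App. D §D.1 (l. 5224)] -/
theorem coe_finAdelicCheck_unitsMap_finiteAdeleSingle_eq_div (hcc : c * c = 1) (w : HeightOneSpectrum (𝓞 E))
    (u : (w.adicCompletion E)ˣ) :
    ((finAdelicCheck F E c hcc (Units.map (finiteAdeleSingle w) u) : finAdelicOne F E c) : (FiniteAdeleRing (𝓞 E) E)ˣ) =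
      Units.map (finiteAdeleSingle w) u /
        Units.map (finiteAdeleSingle (c • w)) (galAdicCompletionUnitsEquiv (L := E) c rfl u) := by
  refine Units.ext ?_
  rw [coe_finAdelicCheck_unitsMap_finiteAdeleSingle, div_eq_mul_inv, ← map_inv, Units.val_mul, Units.coe_map,
    Units.coe_map]
  rfl

omit [NumberField F] in
/-- **`single_w(u) / single_{c • w}(c_* u)` is a norm-one finite idèle** (it is `x/xᶜ` for `x = single_w(u)`).
[cite: Liu2021, App. D §D.1 (l. 5224)] -/
theorem unitsMap_finiteAdeleSingle_div_mem_finAdelicOne (hcc : c * c = 1) (w : HeightOneSpectrum (𝓞 E))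
    (u : (w.adicCompletion E)ˣ) :
    Units.map (finiteAdeleSingle w) u /
        Units.map (finiteAdeleSingle (c • w)) (galAdicCompletionUnitsEquiv (L := E) c rfl u) ∈ finAdelicOne F E c :=
  coe_finAdelicCheck_unitsMap_finiteAdeleSingle_eq_div hcc w u ▸ (finAdelicCheck F E c hcc (Units.map (finiteAdeleSingle w) u)).2

omit [NumberField F] in
/-- `finAdelicCheck (single_w(u)) = ⟨single_w(u) / single_{c • w}(c_* u), _⟩` in `U(1)(𝔸_{F,f})`. [cite: Liu2021, App. D §D.1 (l. 5224)] -/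
theorem finAdelicCheck_unitsMap_finiteAdeleSingle (hcc : c * c = 1) (w : HeightOneSpectrum (𝓞 E)) (u : (w.adicCompletion E)ˣ) :
    finAdelicCheck F E c hcc (Units.map (finiteAdeleSingle w) u) =
      ⟨_, unitsMap_finiteAdeleSingle_div_mem_finAdelicOne hcc w u⟩ :=
  Subtype.ext (coe_finAdelicCheck_unitsMap_finiteAdeleSingle_eq_div hcc w u)

omit [NumberField F] in
/-- **`χ̌_w(u) = χ(single_w(u) / single_{c • w}(c_* u))`**: the local component of `χ̌` at a finite place `w` of `E`, with its
argument written through the `{w, c • w}` dictionary. [cite: Liu2021, App. D §D.1 (l. 5224); Lemma D.1 (4) (l. 5235)] -/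
theorem localComponent_checkOfChi (hcc : c * c = 1) (χ : Chi F E c) (w : HeightOneSpectrum (𝓞 E))
    (u : (w.adicCompletion E)ˣ) :
    (HeckeCharacter.checkOfChi hcc χ).localComponent w u =
      (χ : finAdelicOne F E c →* ℂˣ) ⟨_, unitsMap_finiteAdeleSingle_div_mem_finAdelicOne hcc w u⟩ := by
  rw [localComponent_checkOfChi_apply, finAdelicCheck_unitsMap_finiteAdeleSingle]

/-! ## §3 The graph identity at a split place: `χ̌_w(det z_w) = χ_v(z)` -/

section Split

variable [Algebra.IsQuadraticExtension F E] (hcc : c * c = 1)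
variable {J₁ : Matrix (Fin 1) (Fin 1) E} (hJ₁ : J₁ 0 0 ≠ 0) {v : HeightOneSpectrum (𝓞 F)}

omit [Algebra.IsQuadraticExtension F E] in
/-- components of the finite-adelic point `ι_v(z) ∈ U(J₁)(𝔸_{F,f})` (`z` at `v`, `1` elsewhere) read as a `1 × 1` matrix
entry: at a place `x` of `E` over `v` it is `(z_x)₀₀`, elsewhere `1`. [cite: TateThesis1967, §3.2 Lemma 3.2.1] -/
theorem det_symm_mulSingle_apply (z : localPi E c 1 J₁ v) (x : HeightOneSpectrum (𝓞 E)) :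
    ((Matrix.GeneralLinearGroup.det
        (((finAdelicEquiv F E c 1 J₁).symm (RestrictedProduct.mulSingle (fun v => localInt E c 1 J₁ v) v z) :
            finAdelic F E c 1 J₁) : GL (Fin 1) (FiniteAdeleRing (𝓞 E) E)) : (FiniteAdeleRing (𝓞 E) E)ˣ) :
          FiniteAdeleRing (𝓞 E) E) x =
      if hx : x.under (𝓞 F) = v then
        (((z : LocalGLPi E 1 v) ⟨x, hx⟩ : GL (Fin 1) (x.adicCompletion E)) : Matrix (Fin 1) (Fin 1) (x.adicCompletion E)) 0 0
      else 1 := by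
  set g : finAdelic F E c 1 J₁ :=
    (finAdelicEquiv F E c 1 J₁).symm (RestrictedProduct.mulSingle (fun v => localInt E c 1 J₁ v) v z)
  have hfg : finAdelicEquiv F E c 1 J₁ g = RestrictedProduct.mulSingle (fun v => localInt E c 1 J₁ v) v z :=
    ContinuousMulEquiv.apply_symm_apply _ _
  -- the `x`-component of `det g = g₀₀` is the entry of `GLn.evalAt x g = (finAdelicEquiv g (x.under)) ⟨x, rfl⟩`
  have h1 : ((Matrix.GeneralLinearGroup.det (g : GL (Fin 1) (FiniteAdeleRing (𝓞 E) E)) : (FiniteAdeleRing (𝓞 E) E)ˣ) :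
        FiniteAdeleRing (𝓞 E) E) x =
      ((((finAdelicEquiv F E c 1 J₁ g (x.under (𝓞 F)) : localPi E c 1 J₁ (x.under (𝓞 F))) :
          LocalGLPi E 1 (x.under (𝓞 F))) ⟨x, rfl⟩ : GL (Fin 1) (x.adicCompletion E)) :
            Matrix (Fin 1) (Fin 1) (x.adicCompletion E)) 0 0 := by
    rw [Matrix.GeneralLinearGroup.val_det_apply, Matrix.det_fin_one, finAdelicEquiv_apply_coe, GLn.coe_evalAt_apply]
  rw [h1, hfg]
  by_cases hx : x.under (𝓞 F) = v
  · rw [dif_pos hx]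
    -- transport along `x.under (𝓞 F) = v`
    have key : ∀ (v' : HeightOneSpectrum (𝓞 F)) (hv : v' = v) (w'' : UnitaryGroup.PlacesOver E v'),
        (((RestrictedProduct.mulSingle (fun v => localInt E c 1 J₁ v) v z v' : localPi E c 1 J₁ v') : LocalGLPi E 1 v') w'') =
          (z : LocalGLPi E 1 v) ⟨w''.1, w''.2.trans hv⟩ := by
      intro v' hv w''
      subst hv
      rw [RestrictedProduct.mulSingle_eq_same]
    rw [key (x.under (𝓞 F)) hx ⟨x, rfl⟩]
  · rw [dif_neg hx]
    have key : ∀ (v' : HeightOneSpectrum (𝓞 F)) (hv : v' ≠ v) (w'' : UnitaryGroup.PlacesOver E v'),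
        (((RestrictedProduct.mulSingle (fun v => localInt E c 1 J₁ v) v z v' : localPi E c 1 J₁ v') : LocalGLPi E 1 v') w'') =
          1 := by
      intro v' hv w''
      rw [RestrictedProduct.mulSingle_eq_of_ne _ _ hv]
      rfl
    rw [key (x.under (𝓞 F)) hx ⟨x, rfl⟩, Units.val_one, Matrix.one_apply_eq]

/-- **`single_w(det z_w) / single_w(det z_w)ᶜ = ι_v(z)` in `U(1)(𝔸_{F,f})`** for `z ∈ U(J₁)(F_v) = E_v¹` at a split place
`w ∣ v` (`c • w ≠ w`): both finite idèles are `z_w` at `w`, `z_{c•w} = c_*(z_w)⁻¹` at `c • w` (the unitary relation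
`c_*(z_{c⁻¹ w'}) z_{w'} = 1`, `galMap_entry_mul_entry_eq_one`), and `1` elsewhere.  Here `ι_v(z)` is the point of
`U(J₁)(𝔸_{F,f})` with `v`-component `z` (`finAdelicEquiv⁻¹ ∘ mulSingle v`) read in `E¹(𝔸_{F,f})` by `finAdelicCenterInv = det`.
[cite: Liu2021, App. D §D.1 (l. 5221–5224); proof of Lemma D.1, first paragraph (l. 5241)] -/
theorem finAdelicCheck_unitsMap_finiteAdeleSingle_det (w : UnitaryGroup.PlacesOver E v) (hw : c • w.1 ≠ w.1) (z : localPi E c 1 J₁ v) :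
    finAdelicCheck F E c hcc (Units.map (finiteAdeleSingle w.1) (Matrix.GeneralLinearGroup.det ((z : LocalGLPi E 1 v) w))) =
      finAdelicCenterInv F E c J₁ hJ₁
        ((finAdelicEquiv F E c 1 J₁).symm (RestrictedProduct.mulSingle (fun v => localInt E c 1 J₁ v) v z)) := by
  have hc : c ≠ 1 := by
    rintro rfl
    exact hw (one_smul _ _)
  refine Subtype.ext (Units.ext (FiniteAdeleRing.ext E fun x => ?_))
  rw [coe_finAdelicCenterInv, det_symm_mulSingle_apply]
  by_cases hx : x.under (𝓞 F) = v
  · rw [dif_pos hx]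
    -- `x` lies over `v`: it is `w` or `c⁻¹ • w`
    rcases UnitaryGroup.PlacesOver.eq_or_eq_galInv c hc w ⟨x, hx⟩ with h | h
    · -- `x = w`: both sides are `(z_w)₀₀`
      have hxw : x = w.1 := congrArg Subtype.val h
      subst hxw
      rw [finAdelicCheck_unitsMap_finiteAdeleSingle_apply_self hcc hw, Matrix.GeneralLinearGroup.val_det_apply,
        Matrix.det_fin_one]
    · -- `x = c⁻¹ • w`: the left side is `c_*((z_w)₀₀⁻¹)`, the right side `(z_{c⁻¹ w})₀₀`; they agree by the unitary relation
      have hxw : x = c⁻¹ • w.1 := congrArg Subtype.val h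
      subst hxw
      have hcw : c • w.1 = c⁻¹ • w.1 := by rw [algEquiv_inv_eq_self F hc]
      -- the unitary relation at `w`: `c_*((z_{c⁻¹w})₀₀) · (z_w)₀₀ = 1`
      have hrel := galMap_entry_mul_entry_eq_one E c J₁ hJ₁ v z w
      -- the `w`-entry is the unit `det z_w`
      have hdet : (((z : LocalGLPi E 1 v) w : GL (Fin 1) (w.1.adicCompletion E)) : Matrix (Fin 1) (Fin 1) (w.1.adicCompletion E)) 0 0 =
          ((Matrix.GeneralLinearGroup.det ((z : LocalGLPi E 1 v) w) : (w.1.adicCompletion E)ˣ) : w.1.adicCompletion E) := by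
        rw [Matrix.GeneralLinearGroup.val_det_apply, Matrix.det_fin_one]
      rw [hdet] at hrel
      -- so `c_*((z_{c⁻¹w})₀₀) = (det z_w)⁻¹` and `(z_{c⁻¹w})₀₀ = c⁻¹_*((det z_w)⁻¹) = c_*((det z_w)⁻¹)`
      have hinv : galAdicCompletionMap c (smul_inv_smul c w.1)
          ((((z : LocalGLPi E 1 v) (UnitaryGroup.PlacesOver.galInv c w) : GL (Fin 1) ((UnitaryGroup.PlacesOver.galInv c w).1.adicCompletion E)) :
            Matrix (Fin 1) (Fin 1) ((UnitaryGroup.PlacesOver.galInv c w).1.adicCompletion E)) 0 0) =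
          (((Matrix.GeneralLinearGroup.det ((z : LocalGLPi E 1 v) w))⁻¹ : (w.1.adicCompletion E)ˣ) : w.1.adicCompletion E) :=
        (Units.inv_eq_of_mul_eq_one_left hrel).symm
      have h2 := congrArg (galAdicCompletionMap c⁻¹ (rfl : c⁻¹ • w.1 = (UnitaryGroup.PlacesOver.galInv c w).1)) hinv
      rw [galAdicCompletionMap_inv_apply] at h2
      -- left side at `c⁻¹ • w = c • w`
      have hl : (((finAdelicCheck F E c hcc (Units.map (finiteAdeleSingle w.1) (Matrix.GeneralLinearGroup.det ((z : LocalGLPi E 1 v) w))) :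
            finAdelicOne F E c) : (FiniteAdeleRing (𝓞 E) E)ˣ) : FiniteAdeleRing (𝓞 E) E) (c⁻¹ • w.1) =
          galAdicCompletionMap c hcw
            (((Matrix.GeneralLinearGroup.det ((z : LocalGLPi E 1 v) w))⁻¹ : (w.1.adicCompletion E)ˣ) : w.1.adicCompletion E) := by
        have := finAdelicCheck_unitsMap_finiteAdeleSingle_apply_smul hcc hw (Matrix.GeneralLinearGroup.det ((z : LocalGLPi E 1 v) w))
        -- rewrite the place `c • w.1` as `c⁻¹ • w.1` in the dependent statement
        have key : ∀ (x₁ x₂ : HeightOneSpectrum (𝓞 E)) (hx : x₁ = x₂) (h₁ : c • w.1 = x₁) (h₂ : c • w.1 = x₂)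
            (a : FiniteAdeleRing (𝓞 E) E) (y : w.1.adicCompletion E),
            a x₁ = galAdicCompletionMap c h₁ y → a x₂ = galAdicCompletionMap c h₂ y := by
          intro x₁ x₂ hx h₁ h₂ a y ha
          subst hx
          exact ha
        exact key _ _ hcw rfl hcw _ _ this
      rw [hl]
      calc galAdicCompletionMap c hcw
              (((Matrix.GeneralLinearGroup.det ((z : LocalGLPi E 1 v) w))⁻¹ : (w.1.adicCompletion E)ˣ) : w.1.adicCompletion E)
          = galAdicCompletionMap c⁻¹ (rfl : c⁻¹ • w.1 = (UnitaryGroup.PlacesOver.galInv c w).1)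
              (((Matrix.GeneralLinearGroup.det ((z : LocalGLPi E 1 v) w))⁻¹ : (w.1.adicCompletion E)ˣ) : w.1.adicCompletion E) :=
            galAdicCompletionMap_congr_left E (algEquiv_inv_eq_self F hc).symm hcw rfl _
        _ = (((z : LocalGLPi E 1 v) (UnitaryGroup.PlacesOver.galInv c w) :
              GL (Fin 1) ((UnitaryGroup.PlacesOver.galInv c w).1.adicCompletion E)) :
                Matrix (Fin 1) (Fin 1) ((UnitaryGroup.PlacesOver.galInv c w).1.adicCompletion E)) 0 0 := h2.symm
        _ = _ := rfl
  · rw [dif_neg hx]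
    have h₁ : x ≠ w.1 := fun h => hx (h ▸ w.2)
    have h₂ : x ≠ c • w.1 := fun h => hx (by rw [h, HeightOneSpectrum.under_algEquiv_smul]; exact w.2)
    exact finAdelicCheck_unitsMap_finiteAdeleSingle_apply_of_ne hcc h₁ h₂ _

/-- **THE GRAPH IDENTITY `χ̌_w(det z_w) = χ_v(z)`** for every `z ∈ U(J₁)(F_v) = E_v¹` at a split place `w ∣ v`: the
`w`-component of the global Hecke character `χ̌ = checkOfChi hcc χ`, evaluated at the `w`-coordinate of `z`, is the local
component `χ_v = localCharOfCenter … χ v` of `χ` at `v` evaluated at `z` — print: «Note that the first component of `χ̌` is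
simply `χ`» (proof of Lem. D.1, split case, l. 5241).
[cite: Liu2021, App. D §D.1 (l. 5221–5224); proof of Lemma D.1, first paragraph (l. 5241); Lemma D.1 (4) (l. 5235)] -/
theorem localComponent_checkOfChi_det (χ : Chi F E c) (w : UnitaryGroup.PlacesOver E v) (hw : c • w.1 ≠ w.1)
    (z : localPi E c 1 J₁ v) :
    (HeckeCharacter.checkOfChi hcc χ).localComponent w.1 (Matrix.GeneralLinearGroup.det ((z : LocalGLPi E 1 v) w)) =
      localCharOfCenter F E c J₁ hJ₁ (χ : finAdelicOne F E c →* ℂˣ) v z := by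
  rw [localComponent_checkOfChi_apply, finAdelicCheck_unitsMap_finiteAdeleSingle_det hcc hJ₁ w hw z,
    localCharOfCenter_apply]
  rfl

/-- **`χ′ := χ̌_w` discharges the input `hχ'` of ★ `splitPlace_chiCoinv_iso_parabolicIndGL_explicit`** for the local central
character `χ := χ_v = localCharOfCenter … χ v` (the `∀ z` form, verbatim the binder shape
`∀ z : localPi E c 1 J₁ v, χ' (det ((z : LocalGLPi E 1 v) w)) = χ z` of `SplitPlaceOscillatorModelExplicit`).
[cite: Liu2021, proof of Lemma D.1, first paragraph (l. 5241)] -/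
theorem forall_localComponent_checkOfChi_det (χ : Chi F E c) (w : UnitaryGroup.PlacesOver E v) (hw : c • w.1 ≠ w.1) :
    ∀ z : localPi E c 1 J₁ v,
      (HeckeCharacter.checkOfChi hcc χ).localComponent w.1 (Matrix.GeneralLinearGroup.det ((z : LocalGLPi E 1 v) w)) =
        localCharOfCenter F E c J₁ hJ₁ (χ : finAdelicOne F E c →* ℂˣ) v z :=
  fun z => localComponent_checkOfChi_det hcc hJ₁ χ w hw z

/-- the same for ANY local central character `χv` known to agree with the tree's `localCharOfCenter … χ v` (the shape in
which a consumer holding its own name for `χ_v` uses it). [cite: Liu2021, proof of Lemma D.1, first paragraph (l. 5241)] -/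
theorem forall_localComponent_checkOfChi_det_of_eq (χ : Chi F E c) (w : UnitaryGroup.PlacesOver E v) (hw : c • w.1 ≠ w.1)
    {χv : localPi E c 1 J₁ v →* ℂˣ} (hχv : ∀ z, χv z = localCharOfCenter F E c J₁ hJ₁ (χ : finAdelicOne F E c →* ℂˣ) v z) :
    ∀ z : localPi E c 1 J₁ v,
      (HeckeCharacter.checkOfChi hcc χ).localComponent w.1 (Matrix.GeneralLinearGroup.det ((z : LocalGLPi E 1 v) w)) = χv z :=
  fun z => (localComponent_checkOfChi_det hcc hJ₁ χ w hw z).trans (hχv z).symm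

end Split

/-! ## §4 Values at uniformisers; unitarity -/

omit [NumberField F] in
/-- `χ̌(ϖ_w) = χ(single_w(ϖ_w) / single_w(ϖ_w)ᶜ)` (unfolding of `valueAtUniformizer` for `χ̌`).
[cite: Liu2021, App. D §D.1 (l. 5224); Thm. D.6 (1) proof (l. 5624)] -/
theorem valueAtUniformizer_checkOfChi (hcc : c * c = 1) (χ : Chi F E c) (w : HeightOneSpectrum (𝓞 E)) :
    (HeckeCharacter.checkOfChi hcc χ).valueAtUniformizer w =
      (((χ : finAdelicOne F E c →* ℂˣ) (finAdelicCheck F E c hcc (Units.map (finiteAdeleSingle w) (HeckeCharacter.uniformizer E w))) : ℂˣ) :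
        ℂ) := rfl

/-- **`χ̌(ϖ_w) = χ_v(z)` at a split place** for any `z ∈ U(J₁)(F_v) = E_v¹` whose `w`-coordinate is the chosen uniformiser
`ϖ_w` (`det z_w = uniformizer E w`) — the value entering the second principal-series parameter `μᶜχ̌(ϖ_w)` of
[Liu2021, proof of Lem. D.1 (l. 5241)] / the proof of Thm. D.6 (1). [cite: Liu2021, proof of Lemma D.1, first paragraph (l. 5241); Thm. D.6 (1) proof (l. 5624)] -/
theorem valueAtUniformizer_checkOfChi_eq_localCharOfCenter [Algebra.IsQuadraticExtension F E] (hcc : c * c = 1) {J₁ : Matrix (Fin 1) (Fin 1) E} (hJ₁ : J₁ 0 0 ≠ 0) (χ : Chi F E c) {v : HeightOneSpectrum (𝓞 F)}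
    (w : UnitaryGroup.PlacesOver E v) (hw : c • w.1 ≠ w.1) (z : localPi E c 1 J₁ v)
    (hz : Matrix.GeneralLinearGroup.det ((z : LocalGLPi E 1 v) w) = HeckeCharacter.uniformizer E w.1) :
    (HeckeCharacter.checkOfChi hcc χ).valueAtUniformizer w.1 =
      ((localCharOfCenter F E c J₁ hJ₁ (χ : finAdelicOne F E c →* ℂˣ) v z : ℂˣ) : ℂ) := by
  rw [HeckeCharacter.valueAtUniformizer, ← hz, localComponent_checkOfChi_det hcc hJ₁ χ w hw z]

/-- **`χ̌` is unitary** (`‖χ̌(x)‖ = 1`): `χ` takes values in `ℂ¹` (★ `norm_chi_apply_eq_one`, [Liu2021, Def. 4.11 (l. 2090)]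
«whose value is necessarily in `ℂ¹`»). [cite: Liu2021, Def. 4.11 (l. 2090); App. D §D.1 (l. 5224)] -/
theorem isUnitary_checkOfChi (h2 : Module.finrank F E = 2) (hc : c ≠ 1) (hcc : c * c = 1) (χ : Chi F E c) :
    (HeckeCharacter.checkOfChi hcc χ).IsUnitary := fun x => by
  rw [checkOfChi_apply]
  exact norm_chi_apply_eq_one F E c h2 hc χ _

end Literature.NumberTheory.Automorphic.Liu2021.CheckOfChi

end
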